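import Summits.QuantumFields.YangMills.Theorems.BalabanUVNodesN07Letters10OfRealRows
import Summits.QuantumFields.YangMills.Theorems.UnitScaleTiltProp8FlatScalarExtension
import HarnessLib

/-!
# BalabanUVNodes ∕ N07 — S6, THE `HB` SUMMAND OF (159), PART 2: **print's three letters of a COMPONENTWISE-EXTENDED field `G_V B` (`(G_V B)(b) =
# Σ_c (g e_c)(b)·B(c)`, `g` a REAL operator — print's `H`, `G̃`, `HD`; `B` matrix-valued data) FROM THE REAL ROWS OF `g` ON DATA DOMINATED BY `‖B‖`** — the
# kernel identity `φ ∘ (G_V B) = g(φ ∘ B)` for every real functional `φ` of the duality class, composed with FILE 1's `letters10On_of_(weightedRowsTop ∕ realRows)`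

Cell `pub-ymgap`, width seat `pub-ymgap-dag-n07-w4` gen 2 (director-ym №197 ∕ HUMAN RULING D-0149), node N07 = [15] = [Balaban1985Variational] (CMP **102** (1985) 277–309);
sub-target S6 of plan g81's `W-SEAT-START-LIST.md` v8 § n07 item 4, piece «the `HB` summand's letters from the S5 rows», second half.  `--kind proof --supports
stmt-QuantumFields-20542 --as helper`; count-neutral; def-free; CONSUMED BY NAME, nothing restated: FILE 1 `N07Letters10OfRealRows` (p600098: `letters10On_of_realRows`,
`letters10On_of_weightedRowsTop`), cell ym3-torus's `FlatScalarExtension` (ym-ust-19200-f4: the kernel formula `hGv : (G_V A)(b) = Σ_i (g e_i)(b)·A(i)`, `apply_eq_sum_kernel`),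
k0-s1-w3's generic weights `K0FlatCubeOpsTextP.IsLevWeight`, g0's `Letters10On`.

WHY.  Print p. 288: *«we have suppressed matrix indices of operators acting on the Lie algebra valued functions»*; p. 302: *«all the operators in this section are taken
without any external gauge field configuration»*; p. 303–304 (161)–(165): the bounds on `HB` are bounds of the REAL operator `H` applied to the `𝔤`-valued datum `B`
component by component.  In the tree the matrix-valued `HB` of (159) is the componentwise extension `H_V` of the canonical real `flatH` (k0-s1-w2's
`exists_pairings_transposes_flatOps` ∕ k0-s1-w1's `…Eq158FlatOpsMatrixFields`, kernel formula of ym3-torus's `FlatScalarExtension.exists_extension`), the S5 socket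
(k0-s1-w3's P10∕P12 `hbRows164_…_of_adm22_T4`) bounds the rows of `flatH X` for every REAL datum `X` under near∕far SIZE hypotheses on `|X(c)|`, and FILE 1 turns real
rows of `φ ∘ 𝔄` into `Letters10On Y η_k t 𝔄`.  THIS FILE closes the triangle: for `𝔄 = G_V B`, `φ ∘ 𝔄 = g(φ ∘ B)` (§1) and `|φ(B(c))| ≤ ‖B(c)‖`, so rows of `g X` for
every real datum `X` DOMINATED COMPONENTWISE BY `‖B‖` give the three letters of `G_V B` (§2) — whatever size profile `‖B(c)‖` obeys ((160) near, (155) far) is inherited by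
`X = φ ∘ B` verbatim, so the consumer checks the socket's near∕far hypotheses ONCE, on `‖B‖`.

CONTENTS (finite index type `ι`; `g : (ι → ℝ) →ₗ[ℝ] (κ → ℝ)` resp. `→ₗ[ℝ] (PBond P 0 → ℝ)`; `Gv` its extension through `hGv`).
§1 `reFunctional_extension_apply` ∕ `reFunctional_extension` (any complex normed `V`): `r·Re(u·f((G_V A)(b))) = (g (i ↦ r·Re(u·f(A i))))(b)`.
§2 ★★★ `letters10On_extension_of_weightedRowsTop` (window of top-level sites of a nested family `D`, S5's weighted row shape, unit `η_k`) and ★★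
`letters10On_extension_of_realRows` (any window, plain rows, any unit `ξ > 0`): rows of `g X` for all real `X` with `|X i| ≤ ‖B i‖` ⇒ `Letters10On Y _ t (G_V B)`.

HONEST FRAMING: count-neutral kernel bookkeeping (finite sums + FILE 1 by name); NOTHING of [15] asserted or proved; the rows, the kernel formula and the data sizes are
HYPOTHESES (S5 socket ∕ k0-s1-w2's extension ∕ S3's (160)–(155)); the tokens `LocalLetters165∕167TopStep(Core)` NOT discharged; stub 1 ∕ K0⁷ ∕ K1⁷ NOT closed; N07 NOT
discharged; counts unmoved (typed 28∕28 · discharged 5∕27); one finite 𝕋⁴ programme at fixed ε — R4 closes the conditional finite-𝕋⁴ rung `BalabanLadder.UV` ONLY; the YM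
mass gap (Clay) is NOT proved by any of this; nothing continuum ∕ ℝ⁴ ∕ OS.  No `def`, no `instance`, no `notation`, no `sorry`.
-/

set_option autoImplicit false

noncomputable section

open scoped BigOperators Matrix.Norms.L2Operator

namespace Summit.QuantumFields.YangMills.BalabanUVNodes.N07Letters10OfExtension

open Literature.MathematicalPhysics.QuantumFieldTheory.Balaban1983to89
open Literature.MathematicalPhysics.QuantumFieldTheory.Balaban1983to89.Node00
open B6SectADomainsV1 (Domains)
open B6SectAOperatorsV1 (dcE dcsE)
open Summit.QuantumFields.YangMills.Theorems.FlatScalarExtension (apply_eq_sum_kernel)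
open Summit.QuantumFields.YangMills.Theorems.K0FlatCubeOpsTextP (IsLevWeight)
open Summit.QuantumFields.YangMills.BalabanUVNodes.N07HalvingStepTopOfLocalLetters (Letters10On)
open Summit.QuantumFields.YangMills.BalabanUVNodes.N07Letters10OfRealRows (letters10On_of_realRows letters10On_of_weightedRowsTop)

/-! ## §1  Real functionals pass through a componentwise extension as the scalar operator -/

section Kernel

variable {ι κ : Type*} [Fintype ι] [DecidableEq ι]
variable {V : Type*} [NormedAddCommGroup V] [NormedSpace ℂ V]

/-- **`φ ∘ (G_V A) = g(φ ∘ A)` AT A POINT** for the functionals `φ = (y ↦ r·Re(u·f(y)))` of the duality class (`f` continuous `ℂ`-linear): the real kernel of the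
componentwise extension commutes with real functionals — print's «suppressed matrix indices». [cite: Balaban1985Variational, p.288, (161) p.303] -/
theorem reFunctional_extension_apply (g : (ι → ℝ) →ₗ[ℝ] (κ → ℝ)) {Gv : (ι → V) →ₗ[ℂ] (κ → V)}
    (hGv : ∀ (A : ι → V) (b : κ), Gv A b = ∑ i, ((g (Pi.single i 1) b : ℝ) : ℂ) • A i)
    (f : StrongDual ℂ V) (u : ℂ) (r : ℝ) (A : ι → V) (b : κ) :
    r * (u * f (Gv A b)).re = g (fun i => r * (u * f (A i)).re) b := by
  rw [hGv, map_sum, Finset.mul_sum, Complex.re_sum, Finset.mul_sum, apply_eq_sum_kernel]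
  refine Finset.sum_congr rfl fun i _ => ?_
  rw [map_smul, smul_eq_mul, mul_left_comm, Complex.re_ofReal_mul]
  ring

/-- **`φ ∘ (G_V A) = g(φ ∘ A)` AS REAL FIELDS.** [cite: Balaban1985Variational, p.288, (161) p.303] -/
theorem reFunctional_extension (g : (ι → ℝ) →ₗ[ℝ] (κ → ℝ)) {Gv : (ι → V) →ₗ[ℂ] (κ → V)}
    (hGv : ∀ (A : ι → V) (b : κ), Gv A b = ∑ i, ((g (Pi.single i 1) b : ℝ) : ℂ) • A i)
    (f : StrongDual ℂ V) (u : ℂ) (r : ℝ) (A : ι → V) :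
    (fun b => r * (u * f (Gv A b)).re) = g fun i => r * (u * f (A i)).re :=
  funext fun b => reFunctional_extension_apply g hGv f u r A b

end Kernel

/-! ## §2  The three letters of `G_V B` from the real rows of `g` on data dominated by `‖B‖` -/

section Letters

variable {P : Params} {N : ℕ} [NeZero N]
variable {ι : Type*} [Fintype ι] [DecidableEq ι]

/-- ★★★ **PRINT's THREE LETTERS OF `G_V B` ON A WINDOW OF TOP-LEVEL SITES FROM THE WEIGHTED REAL ROWS OF `g`** (the S5 → S6 socket for the `HB` summand, closed
over the data): `D` a nested family of height `k` with its P2 level weights `w`, `Y ⊆ {x | D.InOm k x}`, `g` a real operator from `ι`-indexed data to fine bond fields with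
componentwise extension `G_V` (`hGv`), `B : ι → M_N(ℂ)` the datum, `0 ≤ q < t`.  If for EVERY real datum `X` dominated componentwise by `‖B‖` (`|X i| ≤ ‖B i‖`) and every
bond `b` based in `Y` the three weighted rows `w₁(b)·(w₁(b)·|(gX)(b)|) ≤ q`, `w₁(b)·(w₂(b)·Lᵏ·|(gX)(b₋+e_ν, b_dir) − (gX)(b)|) ≤ q`, `w₁(b)·(w₃(b)·|(∂*∂(gX))(b)|) ≤ q` hold
(k0-s1-w3's socket shape for `g = flatH`, its near∕far size hypotheses checked once on `‖B‖`), then `Letters10On Y η_k t (G_V B)` — the `h₂` input of g0's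
`letters10On_of_eq159` for `HB = H_V B`. [cite: Balaban1985Variational, (161) p.303, (164)–(165) p.304, p.288; Balaban1985RegularSpaces, (1.2) p.76, (1.140) p.100] -/
theorem letters10On_extension_of_weightedRowsTop {k : ℕ} {D : Domains P} (hDk : D.k = k) {w : ℕ → PBond P 0 → ℝ} (hw : IsLevWeight P k D w)
    {Y : Set (Site P 0)} (hY : ∀ x ∈ Y, D.InOm k x) {q t : ℝ} (hq : 0 ≤ q) (hqt : q < t)
    (g : (ι → ℝ) →ₗ[ℝ] (PBond P 0 → ℝ)) {Gv : (ι → MatA N) →ₗ[ℂ] (PBond P 0 → MatA N)}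
    (hGv : ∀ (A : ι → MatA N) (b : PBond P 0), Gv A b = ∑ i, ((g (Pi.single i 1) b : ℝ) : ℂ) • A i) {B : ι → MatA N}
    (hrows : ∀ X : ι → ℝ, (∀ i, |X i| ≤ ‖B i‖) → ∀ b : PBond P 0, b.src ∈ Y →
      w 1 b * (w 1 b * |g X b|) ≤ q ∧
      (∀ ν : Fin P.d, w 1 b * (w 2 b * (P.L : ℝ) ^ k * |g X ⟨b.src.shift ν, b.dir⟩ - g X b|) ≤ q) ∧
      w 1 b * (w 3 b * |(dcsE ((P.L : ℝ) ^ k) (dcE ((P.L : ℝ) ^ k) (WithLp.toLp 2 (g X)))) b|) ≤ q) :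
    Letters10On Y (P.eta k) t (Gv B) := by
  refine letters10On_of_weightedRowsTop hDk hw hY hq hqt fun f u r hf b hb => ?_
  have hX : ∀ i, |r * (u * f (B i)).re| ≤ ‖B i‖ := fun i => hf (B i)
  obtain ⟨h1, h2, h3⟩ := hrows (fun i => r * (u * f (B i)).re) hX b hb
  refine ⟨?_, fun ν => ?_, ?_⟩
  · rw [reFunctional_extension_apply g hGv]; exact h1
  · rw [reFunctional_extension_apply g hGv, reFunctional_extension_apply g hGv]; exact h2 ν
  · rw [reFunctional_extension g hGv]; exact h3

omit [NeZero N] in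
/-- ★★ **THE SAME ON ANY WINDOW, PLAIN ROWS, ANY UNIT `ξ > 0`** (no nested family: FILE 1's `letters10On_of_realRows` ∘ §1): rows `|(gX)(b)| ≤ q`,
`ξ⁻¹·|(gX)(b₋+e_κ, b_dir) − (gX)(b)| ≤ q`, `|(dcsE ξ⁻¹ (dcE ξ⁻¹ (gX)))(b)| ≤ q` at every bond based in `Y`, for every real `X` dominated by `‖B‖` ⇒ `Letters10On Y ξ t (G_V B)`.
[cite: Balaban1985Variational, (161) p.303, (164)–(165) p.304, p.288] -/
theorem letters10On_extension_of_realRows [NeZero N] {Y : Set (Site P 0)} {ξ q t : ℝ} (hξ : 0 < ξ) (hq : 0 ≤ q) (hqt : q < t)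
    (g : (ι → ℝ) →ₗ[ℝ] (PBond P 0 → ℝ)) {Gv : (ι → MatA N) →ₗ[ℂ] (PBond P 0 → MatA N)}
    (hGv : ∀ (A : ι → MatA N) (b : PBond P 0), Gv A b = ∑ i, ((g (Pi.single i 1) b : ℝ) : ℂ) • A i) {B : ι → MatA N}
    (hrows : ∀ X : ι → ℝ, (∀ i, |X i| ≤ ‖B i‖) → ∀ b : PBond P 0, b.src ∈ Y →
      |g X b| ≤ q ∧ (∀ κ : Fin P.d, ξ⁻¹ * |g X ⟨b.src.shift κ, b.dir⟩ - g X b| ≤ q) ∧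
      |dcsE ξ⁻¹ (dcE ξ⁻¹ (WithLp.toLp 2 (g X))) b| ≤ q) :
    Letters10On Y ξ t (Gv B) := by
  refine letters10On_of_realRows hξ hq hqt fun f u r hf b hb => ?_
  have hX : ∀ i, |r * (u * f (B i)).re| ≤ ‖B i‖ := fun i => hf (B i)
  obtain ⟨h1, h2, h3⟩ := hrows (fun i => r * (u * f (B i)).re) hX b hb
  refine ⟨?_, fun κ => ?_, ?_⟩
  · rw [reFunctional_extension_apply g hGv]; exact h1
  · rw [reFunctional_extension_apply g hGv, reFunctional_extension_apply g hGv]; exact h2 κ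
  · rw [reFunctional_extension g hGv]; exact h3

end Letters

end Summit.QuantumFields.YangMills.BalabanUVNodes.N07Letters10OfExtension

end
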